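import Mathlib
import Summits.ValiantsHypothesis.ValiantsHypothesis.Theorems.FifoMatchingNNDivisionHardPadWordArcBand
import HarnessLib

/-!
# Route FifoMatching — crux `NNDivisionHard` (stmt-ValiantsHypothesis-21181): INTERIOR arcs of the thick queue live in a NARROW band

Third member of the series `…PadWordLongArcs` (all arcs `≥ L − m + 1`) / `…PadWordArcBand` (all arcs `≤ 2L + 2m − 1`).
The INTERIOR arcs of the FIFO pairing of the padded thick word `W = U^L v D^L` — those whose opener is not one of the `L`
padding openers and whose closer is not one of the `L` padding closers — are much more constrained: their length is within
`2m` of `2L`.  (The opener of rank `k ≥ L` is the `(k−L)`-th `U` of `v`, at middle position `≈ 2(k − L) ± m`; the closer of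
rank `k < N/2` is the `k`-th `D` of `v`, at middle position `≈ 2k ± m`.)  At the `NNMonotoneExpBound` parameters
(`m = u³`, `L = 8u⁴ + 3u³`) the interior band is `[16u⁴ + 4u³ + 1, 16u⁴ + 8u³ − 1]`, of RELATIVE width `< 1/(4u)`, and these
bands are pairwise DISJOINT for distinct `u`.

* ★ `card_closers_lt_lt_card_openers_lt_middle` — the MIDDLE delayed inequality: at a middle closer time `t < L + N` whose arc
  has rank `≥ L`, `#closers<t < #openers<(t + 2m − 2L)`;
* ★★ `opener_add_le_closer_middle`, `fifo_padWord_arcs_middle`, `cast_fifo_padWord_arcs_middle` — an interior arc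
  (opener `≥ L`, closer `< L + N`) has length `≥ 2L − 2m + 1`;
* ★★ `exists_thick_measure_narrow`, `exists_thick_measure_of_le_narrow` — the thick-queue measure with the full support
  clause: all arcs in `[L − m + 1, 2L + 2m − 1]` AND interior arcs in `[2L − 2m + 1, 2L + 2m − 1]`; at the parameters of every
  admissible `u`: `[8u⁴ + 2u³ + 1, 16u⁴ + 8u³ − 1]` and interior `[16u⁴ + 4u³ + 1, 16u⁴ + 8u³ − 1]`
  (interior = opener `≥ 8u⁴ + 3u³` and closer `< 2n − (8u⁴ + 3u³)`).

Consumer: `…NarrowBandLocal.lean` (interior certificates need an arc in every narrow band, hence `≳ n^{1/5}` distinct arc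
lengths).  HONEST FRAMING: word combinatorics + an export lemma for ONE measure; stmt-21181 stays OPEN; nothing here bears on
`NNNotVP` or on VP ≠ VNP (NOT proved).  No definitions, no named facts.
References: Grytczuk–Pawlik–Ruciński 2025 Prop. 1 [GrytczukPawlikRucinski2025]; Hrubeš–Yehudayoff 2021 §6 [HrubesYehudayoff2021].
-/

noncomputable section

-- Sub = Summit single-conjunct layout: the duplicated namespace component is mandated by the tree.
set_option linter.dupNamespace false
set_option autoImplicit false

namespace Summit.ValiantsHypothesis.ValiantsHypothesis.Theorems.FifoMatching.NNDivisionHard.PadWordNarrowBand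

open Finset Literature.Computability.AlgebraicComplexity
open Summit.ValiantsHypothesis.ValiantsHypothesis.Theorems.FifoMatching.NNMonotoneHard
open Summit.ValiantsHypothesis.ValiantsHypothesis.Theorems.FifoMatching.NNDivisionHard.PadWordLongArcs
open Summit.ValiantsHypothesis.ValiantsHypothesis.Theorems.FifoMatching.NNDivisionHard.PadWordArcBand
  (cast_fifo_padWord_arcs_band)
open Summit.ValiantsHypothesis.ValiantsHypothesis.Theorems.FifoMatching.NNDivisionHard.ThickMeasureSupport
  (exists_thick_measure_supported)
open scoped NNReal

/-! ### §1 The middle delayed inequality for `U^L v D^L` -/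

section Pad

variable {L N m : ℕ} (v : Fin N → Bool)

/-- ★ **The MIDDLE delayed queue inequality.**  Let `v` be balanced with prefix sums in `(-m, m)` (both sides), `1 ≤ m ≤ L`, and
let `t < L + N` be a closer time of `W = U^L v D^L` with `#closers<t ≥ L` (the arc closed at `t` was opened by a letter of `v`,
not by a padding opener).  Then `#closers<t < #openers<(t + 2m − 2L)`: that arc was opened before time `t − (2L − 2m)`.
[folklore] -/
theorem card_closers_lt_lt_card_openers_lt_middle
    (hbal : 2 * ((univ : Finset (Fin N)).filter fun p => v p = true).card = N)
    (hband : ∀ j, j ≤ N →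
      ((univ : Finset (Fin N)).filter fun p => p.val < j ∧ v p = false).card
        < ((univ : Finset (Fin N)).filter fun p => p.val < j ∧ v p = true).card + m ∧
      ((univ : Finset (Fin N)).filter fun p => p.val < j ∧ v p = true).card
        < ((univ : Finset (Fin N)).filter fun p => p.val < j ∧ v p = false).card + m)
    (hmL : m ≤ L) (hm : 1 ≤ m) {t : ℕ} (htM : t < L + N + L) (htN : t < L + N)
    (ht : padWord L N v ⟨t, htM⟩ = false)
    (hk : L ≤ ((closerSet (padWord L N v)).filter fun i => i.val < t).card) :
    ((closerSet (padWord L N v)).filter fun i => i.val < t).card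
      < ((openerSet (padWord L N v)).filter fun i => i.val < t + 2 * m - 2 * L).card := by
  -- the first `L` letters are openers, so `L ≤ t`
  have hLt : L ≤ t := by
    by_contra hlt
    rw [not_le] at hlt
    have h1 := padWord_apply_of_lt (L := L) (N := N) v (i := ⟨t, htM⟩) hlt
    rw [h1] at ht
    exact Bool.noConfusion ht
  have _hD := two_mul_card_false v hbal
  -- middle phase: `t = L + j`, `j < N`
  obtain ⟨j, rfl⟩ : ∃ j, t = L + j := ⟨t - L, by omega⟩
  have hj : j < N := by omega
  obtain ⟨-, hC⟩ := ranks_padWord_mid (L := L) (N := N) v (j := j) hj.le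
  rw [hC] at hk ⊢
  have hb := (hband j hj.le).1
  have hsum := card_lt_true_add_card_lt_false v hj.le
  -- the delayed time `L + j'`, `j' = j + 2m - 2L ≤ N`
  have e : L + j + 2 * m - 2 * L = L + (j + 2 * m - 2 * L) := by omega
  have hj' : j + 2 * m - 2 * L ≤ N := by omega
  rw [e, (ranks_padWord_mid (L := L) (N := N) v (j := j + 2 * m - 2 * L) hj').1]
  have hb' := (hband (j + 2 * m - 2 * L) hj').1
  have hsum' := card_lt_true_add_card_lt_false v hj'
  omega

/-- ★★ **Interior FIFO arcs of the padded thick word are long**: if the `k`-th opener is not a padding opener (`L ≤ k`) and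
the `k`-th closer is not a padding closer (`c_k < L + N`), then `o_k + (2L − 2m + 1) ≤ c_k`.
[cite: GrytczukPawlikRucinski2025, Prop. 1] -/
theorem opener_add_le_closer_middle
    (hbal : 2 * ((univ : Finset (Fin N)).filter fun p => v p = true).card = N)
    (hband : ∀ j, j ≤ N →
      ((univ : Finset (Fin N)).filter fun p => p.val < j ∧ v p = false).card
        < ((univ : Finset (Fin N)).filter fun p => p.val < j ∧ v p = true).card + m ∧
      ((univ : Finset (Fin N)).filter fun p => p.val < j ∧ v p = true).card
        < ((univ : Finset (Fin N)).filter fun p => p.val < j ∧ v p = false).card + m)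
    (hmL : m ≤ L) (hm : 1 ≤ m) (k : Fin (openerSet (padWord L N v)).card) (hk : L ≤ (k : ℕ))
    (hc : ((closerSet (padWord L N v)).orderEmbOfFin (balanced_padWord v hbal) k : ℕ) < L + N) :
    ((openerSet (padWord L N v)).orderEmbOfFin rfl k : ℕ) + (2 * L - 2 * m + 1)
      ≤ ((closerSet (padWord L N v)).orderEmbOfFin (balanced_padWord v hbal) k : ℕ) := by
  have hWc : padWord L N v ((closerSet (padWord L N v)).orderEmbOfFin (balanced_padWord v hbal) k) = false :=
    apply_closer (balanced_padWord v hbal) k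
  have hrk : ((closerSet (padWord L N v)).filter fun i =>
      i < (closerSet (padWord L N v)).orderEmbOfFin (balanced_padWord v hbal) k).card = k :=
    card_filter_lt_orderEmbOfFin (balanced_padWord v hbal) k
  rw [filter_lt_fin_eq] at hrk
  -- the middle delayed inequality at time `c`
  have hdel := card_closers_lt_lt_card_openers_lt_middle v hbal hband hmL hm
    ((closerSet (padWord L N v)).orderEmbOfFin (balanced_padWord v hbal) k).isLt hc hWc (by rw [hrk]; exact hk)
  rw [hrk] at hdel
  -- hence `o_k < c + 2m - 2L`
  have htM : ((closerSet (padWord L N v)).orderEmbOfFin (balanced_padWord v hbal) k : ℕ) + 2 * m - 2 * L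
      < L + N + L := by
    have := ((closerSet (padWord L N v)).orderEmbOfFin (balanced_padWord v hbal) k).isLt
    omega
  have hlt : (openerSet (padWord L N v)).orderEmbOfFin rfl k
      < (⟨((closerSet (padWord L N v)).orderEmbOfFin (balanced_padWord v hbal) k : ℕ) + 2 * m - 2 * L, htM⟩ :
        Fin (L + N + L)) := by
    rw [orderEmbOfFin_lt_iff, filter_lt_fin_eq]
    exact hdel
  rw [Fin.lt_def] at hlt
  change ((openerSet (padWord L N v)).orderEmbOfFin rfl k : ℕ)
    < ((closerSet (padWord L N v)).orderEmbOfFin (balanced_padWord v hbal) k : ℕ) + 2 * m - 2 * L at hlt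
  omega

/-- ★★ **Interior arcs of `fifo (U^L v D^L)` have length `≥ 2L − 2m + 1`**: for an opener `i ≥ L` with `fifo W h i < L + N`,
`i + (2L − 2m + 1) ≤ fifo W h i`. [cite: GrytczukPawlikRucinski2025, Prop. 1] -/
theorem fifo_padWord_arcs_middle
    (hbal : 2 * ((univ : Finset (Fin N)).filter fun p => v p = true).card = N)
    (hband : ∀ j, j ≤ N →
      ((univ : Finset (Fin N)).filter fun p => p.val < j ∧ v p = false).card
        < ((univ : Finset (Fin N)).filter fun p => p.val < j ∧ v p = true).card + m ∧
      ((univ : Finset (Fin N)).filter fun p => p.val < j ∧ v p = true).card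
        < ((univ : Finset (Fin N)).filter fun p => p.val < j ∧ v p = false).card + m)
    (hmL : m ≤ L) (hm : 1 ≤ m) {i : Fin (L + N + L)} (hi : padWord L N v i = true) (hiL : L ≤ (i : ℕ))
    (hc : (fifo (padWord L N v) (balanced_padWord v hbal) i : ℕ) < L + N) :
    (i : ℕ) + (2 * L - 2 * m + 1) ≤ (fifo (padWord L N v) (balanced_padWord v hbal) i : ℕ) := by
  obtain ⟨k, rfl⟩ := exists_eq_opener hi
  rw [fifo_opener] at hc ⊢
  -- the rank of an opener `≥ L` is `≥ L`
  have hLM : L < L + N + L := by omega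
  have hk : L ≤ (k : ℕ) := by
    have h1 : (⟨L, hLM⟩ : Fin (L + N + L)) ≤ (openerSet (padWord L N v)).orderEmbOfFin rfl k := by
      rw [Fin.le_def]; exact hiL
    rw [le_orderEmbOfFin_iff, filter_lt_fin_eq] at h1
    have h2 := (ranks_padWord_head (L := L) (N := N) v (t := L) le_rfl).1
    change ((openerSet (padWord L N v)).filter fun i => i.val < L).card ≤ (k : ℕ) at h1
    omega
  exact opener_add_le_closer_middle v hbal hband hmL hm k hk hc

/-- ★★ **Transported NARROW-BAND form** (matchings of `Fin (2n)`, `2n = L + N + L`): every arc of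
`M = (i ↦ cast (fifo (U^L v D^L) (cast⁻¹ i)))` has length in `[L − m + 1, 2L + 2m − 1]`, and every INTERIOR arc (`L ≤ i`,
`M i < L + N`) has length `≥ 2L − 2m + 1`. [cite: GrytczukPawlikRucinski2025, Prop. 1] -/
theorem cast_fifo_padWord_arcs_narrow {n : ℕ} (hM : L + N + L = 2 * n)
    (hbal : 2 * ((univ : Finset (Fin N)).filter fun p => v p = true).card = N)
    (hband : ∀ j, j ≤ N →
      ((univ : Finset (Fin N)).filter fun p => p.val < j ∧ v p = false).card
        < ((univ : Finset (Fin N)).filter fun p => p.val < j ∧ v p = true).card + m ∧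
      ((univ : Finset (Fin N)).filter fun p => p.val < j ∧ v p = true).card
        < ((univ : Finset (Fin N)).filter fun p => p.val < j ∧ v p = false).card + m)
    (hmL : m ≤ L) (hm : 1 ≤ m) :
    ∀ i ∈ openers (fun i : Fin (2 * n) =>
        Fin.cast hM (fifo (padWord L N v) (balanced_padWord v hbal) (Fin.cast hM.symm i))),
      ((i : ℕ) + (L - m + 1)
          ≤ (Fin.cast hM (fifo (padWord L N v) (balanced_padWord v hbal) (Fin.cast hM.symm i)) : ℕ) ∧
        (Fin.cast hM (fifo (padWord L N v) (balanced_padWord v hbal) (Fin.cast hM.symm i)) : ℕ) + 1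
          ≤ (i : ℕ) + (2 * L + 2 * m)) ∧
      (L ≤ (i : ℕ) → (Fin.cast hM (fifo (padWord L N v) (balanced_padWord v hbal) (Fin.cast hM.symm i)) : ℕ) < L + N →
        (i : ℕ) + (2 * L - 2 * m + 1)
          ≤ (Fin.cast hM (fifo (padWord L N v) (balanced_padWord v hbal) (Fin.cast hM.symm i)) : ℕ)) := by
  intro i hi
  refine ⟨cast_fifo_padWord_arcs_band v hM hbal hband hmL hm i hi, fun hiL hc => ?_⟩
  rw [mem_openers, Fin.lt_def, Fin.val_cast] at hi
  have hio : padWord L N v (Fin.cast hM.symm i) = true :=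
    (lt_fifo_iff (isBallot_padWord v hbal (fun j hj => (hband j hj).1) hmL) (Fin.cast hM.symm i)).1
      (by rw [Fin.lt_def, Fin.val_cast]; exact hi)
  rw [Fin.val_cast] at hc
  have h := fifo_padWord_arcs_middle v hbal hband hmL hm hio (by rw [Fin.val_cast]; exact hiL) hc
  rw [Fin.val_cast] at h
  rw [Fin.val_cast]
  exact h

end Pad

/-! ### §2 The thick-queue measure: full support clause -/

/-- ★★ **The thick-queue measure, NARROW-BAND form.**  Under the hypotheses of `NNMonotoneHard.exists_thick_measure`: a
probability weighting of the nest-free perfect matchings of `[2n]` respecting every balanced split with mass `≤ 2N (3/4)^r`,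
supported on matchings all of whose arcs have length in `[L − m + 1, 2L + 2m − 1]` and all of whose INTERIOR arcs (opener `≥ L`,
closer `< L + N`) have length in `[2L − 2m + 1, 2L + 2m − 1]`. [cite: HrubesYehudayoff2021, §6 Problem 2] -/
theorem exists_thick_measure_narrow {n L N m K J r : ℕ} (hM : L + N + L = 2 * n)
    (hmL : m ≤ L) (hm : 1 ≤ m) (hK : 2 * L + 4 * m + 2 ≤ K) (hJ : J * K + 1 ≤ N)
    (hr1 : 4 * r ≤ J) (hr3 : 2 * m * r + 3 * m ≤ L)
    (hreg : 3 * (2 * K * r + (2 * n - J * K)) ≤ 2 * n)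
    (hNpos : 0 < N)
    (hband : 2 * (N : ℝ) * Real.exp (-((m : ℝ) ^ 2 / (2 * N))) * 2 ^ N ≤ 2 ^ N / (2 * N)) :
    ∃ μ : (Fin (2 * n) → Fin (2 * n)) → ℝ≥0,
      (∑ Mt ∈ nestFreeMatchings (2 * n), μ Mt = 1) ∧
      (∀ S : Finset (Fin (2 * n)), 2 * n < 3 * S.card → 3 * S.card ≤ 4 * n →
        (∑ Mt ∈ (nestFreeMatchings (2 * n)).filter (fun Mt => ∀ i, i ∈ S ↔ Mt i ∈ S), μ Mt)
          ≤ (2 * N : ℝ≥0) * ((3 : ℝ≥0) / 4) ^ r) ∧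
      (∀ Mt ∈ nestFreeMatchings (2 * n), μ Mt ≠ 0 → ∀ i ∈ openers Mt,
        ((i : ℕ) + (L - m + 1) ≤ (Mt i : ℕ) ∧ (Mt i : ℕ) + 1 ≤ (i : ℕ) + (2 * L + 2 * m)) ∧
        (L ≤ (i : ℕ) → (Mt i : ℕ) < L + N → (i : ℕ) + (2 * L - 2 * m + 1) ≤ (Mt i : ℕ))) := by
  obtain ⟨μ, h1, h2, h3⟩ := exists_thick_measure_supported hM hmL hm hK hJ hr1 hr3 hreg hNpos hband
  refine ⟨μ, h1, h2, fun Mt _ hMt => ?_⟩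
  obtain ⟨v, hb, hbd, rfl⟩ := h3 Mt hMt
  exact cast_fifo_padWord_arcs_narrow v hM hb hbd hmL hm

/-- ★★ **The narrow-banded thick-queue measure at EVERY admissible parameter** (`u ≥ 1`, `m = u³`, `L = 8mu + 3m`,
`K = 2L + 4m + 2`, `N = 2n − 2L`, every `n ≥ 12Ku + 3L + 2K` with the band estimate): mass `≤ 2N (3/4)^{4u}` on every balanced
split; support on matchings with all arcs of length in `[8u⁴ + 2u³ + 1, 16u⁴ + 8u³ − 1]` and all interior arcs (opener
`≥ 8u⁴ + 3u³`, closer `< 2n − (8u⁴ + 3u³)`) of length in `[16u⁴ + 4u³ + 1, 16u⁴ + 8u³ − 1]`. [folklore] -/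
theorem exists_thick_measure_of_le_narrow {u n m L K N : ℕ} (hu : 1 ≤ u) (hm : m = u ^ 3)
    (hL : L = 8 * m * u + 3 * m) (hK : K = 2 * L + 4 * m + 2) (hN : N = 2 * n - 2 * L)
    (hT : 12 * K * u + 3 * L + 2 * K ≤ n)
    (hband : 2 * (N : ℝ) * Real.exp (-((m : ℝ) ^ 2 / (2 * N))) * 2 ^ N ≤ 2 ^ N / (2 * N)) :
    ∃ μ : (Fin (2 * n) → Fin (2 * n)) → ℝ≥0,
      (∑ Mt ∈ nestFreeMatchings (2 * n), μ Mt = 1) ∧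
      (∀ S : Finset (Fin (2 * n)), 2 * n < 3 * S.card → 3 * S.card ≤ 4 * n →
        (∑ Mt ∈ (nestFreeMatchings (2 * n)).filter (fun Mt => ∀ i, i ∈ S ↔ Mt i ∈ S), μ Mt)
          ≤ (2 * N : ℝ≥0) * ((3 : ℝ≥0) / 4) ^ (4 * u)) ∧
      (∀ Mt ∈ nestFreeMatchings (2 * n), μ Mt ≠ 0 → ∀ i ∈ openers Mt,
        ((i : ℕ) + (8 * u ^ 4 + 2 * u ^ 3 + 1) ≤ (Mt i : ℕ) ∧ (Mt i : ℕ) + 1 ≤ (i : ℕ) + (16 * u ^ 4 + 8 * u ^ 3)) ∧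
        (8 * u ^ 4 + 3 * u ^ 3 ≤ (i : ℕ) → (Mt i : ℕ) + (8 * u ^ 4 + 3 * u ^ 3) < 2 * n →
          (i : ℕ) + (16 * u ^ 4 + 4 * u ^ 3 + 1) ≤ (Mt i : ℕ))) := by
  set J : ℕ := (N - 1) / K with hJ
  have hKpos : 0 < K := by rw [hK]; omega
  have hm1 : 1 ≤ m := by rw [hm]; exact Nat.one_le_pow _ _ hu
  -- linearise the products for `omega`
  have eT : 12 * K * u = 12 * (K * u) := by ring
  have eL : 8 * m * u = 8 * (m * u) := by ring
  have er : 2 * K * (4 * u) = 8 * (K * u) := by ring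
  have e16 : 4 * (4 * u) * K = 16 * (K * u) := by ring
  have emr : 2 * m * (4 * u) + 3 * m = 8 * (m * u) + 3 * m := by ring
  have e4 : u ^ 4 = m * u := by rw [hm]; ring
  rw [eT] at hT
  have hLn : L ≤ n := by omega
  have hM : L + N + L = 2 * n := by rw [hN]; omega
  have hmL : m ≤ L := by rw [hL, eL]; omega
  have hKe : 2 * L + 4 * m + 2 ≤ K := by rw [hK]
  have hNpos : 0 < N := by rw [hN]; omega
  -- `J K ≤ N - 1 < J K + K`
  have hdiv : K * J + (N - 1) % K = N - 1 := by rw [hJ]; exact Nat.div_add_mod (N - 1) K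
  have hmod : (N - 1) % K < K := Nat.mod_lt _ hKpos
  have eKJ : K * J = J * K := Nat.mul_comm _ _
  have hJK : J * K + 1 ≤ N := by omega
  have hJK' : N ≤ J * K + K := by omega
  have hr1 : 4 * (4 * u) ≤ J := by
    rw [hJ, Nat.le_div_iff_mul_le hKpos, e16]
    omega
  have hr3 : 2 * m * (4 * u) + 3 * m ≤ L := by rw [emr, hL, eL]
  have hreg : 3 * (2 * K * (4 * u) + (2 * n - J * K)) ≤ 2 * n := by
    rw [er]
    omega
  obtain ⟨μ, h1, h2, h3⟩ := exists_thick_measure_narrow hM hmL hm1 hKe hJK hr1 hr3 hreg hNpos hband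
  refine ⟨μ, h1, h2, fun Mt hMt hμ i hi => ?_⟩
  obtain ⟨⟨hlo, hhi⟩, hmid⟩ := h3 Mt hMt hμ i hi
  have eLu : L = 8 * u ^ 4 + 3 * u ^ 3 := by rw [hL, eL, e4, hm]
  have elo : L - m + 1 = 8 * u ^ 4 + 2 * u ^ 3 + 1 := by rw [hL, eL, e4, hm]; omega
  have ehi : 2 * L + 2 * m = 16 * u ^ 4 + 8 * u ^ 3 := by rw [hL, eL, e4, hm]; ring
  have emid : 2 * L - 2 * m + 1 = 16 * u ^ 4 + 4 * u ^ 3 + 1 := by rw [hL, eL, e4, hm]; omega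
  rw [elo] at hlo
  rw [ehi] at hhi
  refine ⟨⟨hlo, hhi⟩, fun hiL hc => ?_⟩
  have hLN : L + N = 2 * n - L := by omega
  have h := hmid (by rw [eLu]; exact hiL) (by rw [hLN, eLu]; omega)
  rw [emid] at h
  exact h

end Summit.ValiantsHypothesis.ValiantsHypothesis.Theorems.FifoMatching.NNDivisionHard.PadWordNarrowBand

end
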